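import Literature.NumberTheory.EllipticCurves.RootNumberAtkinLehner
import Literature.NumberTheory.EllipticCurves.RootNumberTableThree
import HarnessLib

/-!
# The Atkin–Lehner eigenvalue at `3` is Rizzo's local root number `W₃` (Kellock–Dokchitser 2023, Rem. 2.2, at `p = 3`)

Sibling of `RootNumberAtkinLehner.lean`, whose named fact `WeierstrassCurve.atkinLehnerEigenvalueAt_eq_localRootNumberAt`
(Kellock–Dokchitser 2023, Remark 2.2 — held copy `paper:arxiv-2303.07883`, p. 7, verbatim: "For an elliptic curve defined
over `ℚ`, the local root number at a prime `p` agrees with the eigenvalue of the associated Atkin–Lehner involution for the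
associated modular form. This follows from the corresponding statement for modular forms (see [Schmidt 2002] Theorem
3.2.2, for example) together with the local Langlands conjecture for `GL₂` and the modularity of elliptic curves over `ℚ`")
carries the guard «additive reduction at `v_p` only if `p > 3`», solely because the tree's Rohrlich-style
`localRootNumberAt` has the documented junk value `0` at an additive place of residue characteristic `2, 3`.  At `p = 3` the
tree now has the honest value: `W.rootNumberThree` = Rizzo's Table II `W₃` on the invariants `(c₄, c₆, Δ)` of any equation
of the curve (`RootNumberTableThree.lean`; O. G. Rizzo, Compositio Math. 136 (2003), §1.2 and Table II "The local root number
`W₃`" (p. 4), after Halberstadt 1998; rows cover good, (potentially) multiplicative and additive reduction).  This file vendors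
Remark 2.2 AT THE PRIME `3` with that value on the right-hand side — the case the cell bsd-f2-manin needs (desc g22, row
E-desc-160 `AtkinLehnerSignThreeEqRootNumberThree` of `…/ManinAdditive/ThetaFourOmegaSign.lean`; census there: Kodaira × sign
506/506 at `9 ∥ N ≤ 1300` and PARI `ellrootno(E,3)` 458 427/458 427 classes `9 ∥ N < 5·10⁵`).  ONE named fact, statement only,
in the conventions of the sibling (newform at level the conductor, `atkinLehnerEigenvalueAt f 3 = λ(Q₃)`, `Q₃ = 3^{v₃(N_W)}`,
Knapp's normalisation, `λ = ±1`); at `3 ∥ N_W` it is already a tree theorem up to the identification of Rizzo's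
multiplicative rows with Rohrlich's value (`atkinLehnerEigenvalueAt_eq_localRootNumberAt_of_not_sq_dvd`).

## References
* [KellockDokchitser2023] L. Cowland Kellock, V. Dokchitser, Bull. LMS 55 (2023), Rem. 2.2 (p. 7 of arXiv:2303.07883).
* [Rizzo2003] O. G. Rizzo, Compositio Math. 136 (2003) 1–23, §1.2 and Table II (p. 4): `W₃ = w(E/ℚ₃)`.
* [Schmidt2002JRMS] R. Schmidt, J. Ramanujan Math. Soc. 17 (2002), Thm. 3.2.2 (not held).
* [Knapp1993] A. W. Knapp, Elliptic curves, Thm. 9.27 (the involutions `w_{Q_p}` and `λ = ±1`).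
-/

noncomputable section

open scoped MatrixGroups

open CongruenceSubgroup Literature.NumberTheory.EllipticCurves.ModularForms IsDedekindDomain

namespace WeierstrassCurve

variable (W : WeierstrassCurve ℚ)

/-- **The Atkin–Lehner eigenvalue at `3` of the newform of `E / ℚ` is the local root number `w(E/ℚ₃)`, read from Rizzo's
Table II** (Kellock–Dokchitser 2023, Remark 2.2, verbatim: "For an elliptic curve defined over `ℚ`, the local root number
at a prime `p` agrees with the eigenvalue of the associated Atkin–Lehner involution for the associated modular form";
Rizzo 2003, Table II: `W₃ = w(E/ℚ₃)` as a function of `(c₄, c₆, Δ)`, the tree's `W.rootNumberThree`).  Rendering (module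
docstring; conventions of `atkinLehnerEigenvalueAt_eq_localRootNumberAt`): for the newform `f ∈ S₂(Γ₀(N_W))` of `W`
(`IsNewformOf W f`) and `3 ∣ N_W`: `λ(Q₃)(f) = W₃(E)`.  Named fact (statement only); it is the `p = 3` case that the
sibling fact excludes by its junk-value guard. [cite: KellockDokchitser2023, Rem. 2.2 (p. 7)]
[cite: Rizzo2003, §1.2 and Table II (p. 4)] [cite: Knapp1993, Thm. 9.27] -/
def atkinLehnerEigenvalueAt_three_eq_rootNumberThree : Prop :=
  ∀ [W.IsElliptic] [NeZero (W.conductorNorm ℤ)]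
    {f : CuspForm (Gamma0 (W.conductorNorm ℤ)) 2} (_hf : IsNewformOf W f) (_h3 : 3 ∣ W.conductorNorm ℤ),
    atkinLehnerEigenvalueAt f 3 = (W.rootNumberThree : ℂ)

-- TODO(general form): the `p = 2` twin with the corrected Kellock–Dokchitser Table value `W.rootNumberTwo'`
-- (`RootNumberTableTwo.lean`), and the guard-free all-`p` statement once `localRootNumberAt` is repaired at `2, 3`.

end WeierstrassCurve

end
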